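import Summits.ABC.IUTFork.Conditional.AbcOfSGenuineKWindowDatum
import Literature.IUT.LogVolume.Corollary22PartIILemmas
import HarnessLib

/-!
# R-W lane U, task T4 «SZPIRO-BAD ⇒ DEEP?»: what the Szpiro-bad disjunct of the cut of record yields per place, and a uniform
# WINDOW-membership criterion — the two thresholds do not meet

PROOF-ONLY file (no `def`, no new `Prop`, no `instance`) of the abc-iut cell (seat abc-iut-w4-d078 g6; D-0079 R-W task T4 of
`plan/W/WINDOW-SPEC.md` §2b / ruling C-R28 (2); liaison abc-iut-rp-j2 `Repair.RHPlaceCutCertificate.abc_of_T4_v10K_window_szpiroBadBoth`,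
p456095). TAKES NO SIDE on [IUTchIII] Cor. 3.12 or on any author.

The cut of record `Conditional.abc_of_SH_v10K_window_szpiroBadBoth` (abc-iut-c312-d1 p450130) demands the hull-level clause `hSHwBad`
only at admissible `(P, l)` that are SZPIRO-BAD — `(l+5)/4 < d_mod ∨ c₁·(log-diff + (1−1/l)·log 𝔣^{∤2l}) + c₂·log π < log q^{∤2l}(λ)` with
`c₁ = 6l(l+5−4d_mod)/((l+4)(l−3))`, `c₂ = 6l(l+5)/((l+4)(l−3))` — and only at Θ-volume data `T` OFF the degree-form depth locus
(abc-iut-C-cert-2's `GenuineK.deep_iff_deepOrd`, p445646: `DeepOrd(T)` ⟺ some packet `(p > 2, j = i+1 ≤ l⋆, x₀ | p bad)` has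
`p^{((i+2)(4+2·log_p[K:ℚ]))+1} · (p^{ord_{x₀}(j_E)/(2l·e_{x₀})})^{(i+1)²−1} < 1`).  T4 asks whether SZPIRO-BAD forces DEEP (then `hSHwBad` would
be vacuous).  This file records, in the kernel, the two one-sided facts that answer T4 NEGATIVELY AT THE NUMERIC LEVEL:

* `Cor22.exists_localHeight_gt_of_szpiroBad` — at `d_mod ≤ (l+5)/4`, `l ≥ 5`, the Szpiro-type strict inequality yields a bad place
  `v ∤ 2l` of `F_tpd` with local height `h_v > c₁·(1 − 1/l)` (averaging: `log q^{∤2l} = Σ h_v·deĝ̲[v] ≤ (max h_v)·log 𝔣^{∤2l}`, and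
  `log-diff ≥ 0`, `log π > 0` are on the small side); `Cor22.szpiroCoeff_mul_le_eight` — this per-place threshold is `≤ 8` for every
  `l ≥ 5`, `d_mod ≥ 1`.  This is ALL the Szpiro-bad disjunct says place by place.
* `Conditional.GenuineK.not_deepOrd_of_neg_ord_jE_le` — for an initial Θ-datum `D` over `K`: if EVERY bad place `x₀` of `K` over an odd
  prime has `−ord_{x₀}(j_E) ≤ 16·e_{x₀}`, then `¬ DeepOrd` (the right-hand side of `GenuineK.deep_iff_deepOrd`, VERBATIM), uniformly in
  `[K:ℚ]` (the `log_p[K:ℚ]` term only raises the bar): at label `j = i+1 ≤ l⋆` the exponent is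
  `≥ 4i + 9 − 8((i+1)²−1)/l ≥ 0` because `l = 2l⋆+1 ≥ 2i+3`.  Corollary `…not_deep_of_neg_ord_jE_le` for the chosen-idele form.
  READING for the window table: a datum all of whose bad places satisfy `H_{x₀} ≤ 16·e_{x₀}` (equivalently `h_v ≤ 16·e_v` below, since
  `H_{x₀} = e(x₀|v)·h_v`, `e_{x₀} = e(x₀|v)·e_v`) is NEVER decided by the degree form at any packet — it sits in the WINDOW.

Since `c₁(1−1/l) ≤ 8 < 16 ≤ 16·e`, the profile «every bad local height in `(8, 16]`» is Szpiro-bad-capable and nowhere deep: SZPIRO-BAD does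
not imply DEEP through these numerics, so `hSHwBad` is not vacuous by this route (a kernel refutation of T4 at GENUINE data would need an
initial Θ-datum at such a point — construction debt G-L5t7g4-1 — and is not attempted).  Nothing here asserts the existence of any datum,
nor `Cor312Of` for any datum; typed ≠ proved; a numeric non-implication is not a refutation in print.
[cite: Mochizuki2012, IUTchIV Thm. 1.10 p. 22–23, Cor. 2.2 (ii) proof (P2)(P5) p. 45–46; IUTchIII Cor. 3.12 p. 173–174]
[cite: DupuyHilado2025, §3.3, §3.4] [claim: Mochizuki2012, status: disputed]
-/

noncomputable section

open Set Function NumberField IsDedekindDomain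

/-! ## §1. The Szpiro-bad disjunct, place by place (`NFPoint` level) -/

namespace Literature.IUT.LogVolume.Cor22

open Literature.NumberTheory.DiophantineGeometry.GenEll

variable {P : NFPoint} {l : ℕ}

/-- **Averaging**: if every bad place `v ∤ 2l` of `F_tpd` has local height `h_v ≤ c`, then `log q^{∤2l}(λ) ≤ c · log 𝔣^{∤2l}(λ)`
(`log q^{∤2l} = Σ_{v bad, v∤2l} h_v · ln|κ(v)|/[F:ℚ]`, `log 𝔣^{∤2l} = Σ_{v bad, v∤2l} ln|κ(v)|/[F:ℚ]`).
[cite: Mochizuki2012, IUTchIV Cor. 2.2 (ii) proof (P5) p. 46] [claim: Mochizuki2012, status: disputed] -/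
theorem logQAvoid_le_mul_logCondAvoid_of_forall_localHeight_le (c : ℝ)
    (h : ∀ v ∈ badPlaces P, ((2 : ℕ) : 𝓞 P.F) ∉ v.asIdeal → ((l : ℕ) : 𝓞 P.F) ∉ v.asIdeal → localHeight P v ≤ c) :
    logQAvoid P {2, l} ≤ c * logCondAvoid P {2, l} := by
  classical
  unfold logQAvoid qDivisor logCondAvoid condDivisor
  rw [map_sum, map_sum, Finset.mul_sum]
  refine Finset.sum_le_sum fun v hv => ?_
  rw [FinDivisor.ndeg_of, FinDivisor.ndeg_of, one_mul, mul_div_assoc]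
  obtain ⟨hvbad, hvS⟩ := Finset.mem_filter.mp hv
  have h2 : ((2 : ℕ) : 𝓞 P.F) ∉ v.asIdeal := hvS 2 (by simp)
  have hl : ((l : ℕ) : 𝓞 P.F) ∉ v.asIdeal := hvS l (by simp)
  exact mul_le_mul_of_nonneg_right (h v hvbad h2 hl)
    (div_nonneg (logNorm_pos P.F v).le (FinDivisor.finrank_pos (F := P.F)).le)

/-- **T4, Szpiro side: what the Szpiro-bad disjunct of the cut of record (abc-iut-c312-d1 p450130) yields per place.**  For `λ ∈ U_X`
with `d_mod ≤ (l+5)/4` and `l ≥ 5`, the strict inequality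
`c₁·(log-diff + (1−1/l)·log 𝔣^{∤2l}) + c₂·log π < log q^{∤2l}` (`c₁ = 6l(l+5−4d_mod)/((l+4)(l−3))`, `c₂ = 6l(l+5)/((l+4)(l−3))`) forces a
bad place `v ∤ 2l` of `F_tpd` with local height `h_v > c₁·(1 − 1/l)`: otherwise `log q^{∤2l} ≤ c₁(1−1/l)·log 𝔣^{∤2l}` by averaging while
`c₁·log-diff ≥ 0` and `c₂·log π > 0`.  (By `szpiroCoeff_mul_le_eight` the threshold is `≤ 8`.)
[cite: Mochizuki2012, IUTchIV Cor. 2.2 (ii) proof (P2)(P5) p. 45–46] [claim: Mochizuki2012, status: disputed] -/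
theorem exists_localHeight_gt_of_szpiroBad (h5 : 5 ≤ l) (hd : (dmod P : ℝ) ≤ ((l : ℝ) + 5) / 4)
    (hbad : 6 * l * (((l : ℝ) + 5) - 4 * dmod P) / (((l : ℝ) + 4) * ((l : ℝ) - 3))
            * (P.logDiff + (1 - 1 / (l : ℝ)) * logCondAvoid P {2, l})
          + 6 * l * ((l : ℝ) + 5) / (((l : ℝ) + 4) * ((l : ℝ) - 3)) * Real.log Real.pi < logQAvoid P {2, l}) :
    ∃ v ∈ badPlaces P, ((2 : ℕ) : 𝓞 P.F) ∉ v.asIdeal ∧ ((l : ℕ) : 𝓞 P.F) ∉ v.asIdeal ∧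
      6 * l * (((l : ℝ) + 5) - 4 * dmod P) / (((l : ℝ) + 4) * ((l : ℝ) - 3)) * (1 - 1 / (l : ℝ)) < localHeight P v := by
  by_contra hcon
  simp only [not_exists, not_and, not_lt] at hcon
  have hl5 : (5 : ℝ) ≤ l := by exact_mod_cast h5
  have hc₁ : 0 ≤ 6 * l * (((l : ℝ) + 5) - 4 * dmod P) / (((l : ℝ) + 4) * ((l : ℝ) - 3)) :=
    div_nonneg (mul_nonneg (by positivity) (by linarith)) (mul_pos (by linarith) (by linarith)).le
  have hc₂ : 0 < 6 * l * ((l : ℝ) + 5) / (((l : ℝ) + 4) * ((l : ℝ) - 3)) :=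
    div_pos (by positivity) (mul_pos (by linarith) (by linarith))
  have hπ : 0 < Real.log Real.pi := Real.log_pos (by linarith [Real.pi_gt_three])
  have hkey := logQAvoid_le_mul_logCondAvoid_of_forall_localHeight_le (P := P) (l := l)
    (6 * l * (((l : ℝ) + 5) - 4 * dmod P) / (((l : ℝ) + 4) * ((l : ℝ) - 3)) * (1 - 1 / (l : ℝ)))
    (fun v hv h2 hl => hcon v hv h2 hl)
  have e1 : 6 * l * (((l : ℝ) + 5) - 4 * dmod P) / (((l : ℝ) + 4) * ((l : ℝ) - 3))
        * (P.logDiff + (1 - 1 / (l : ℝ)) * logCondAvoid P {2, l}) =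
      6 * l * (((l : ℝ) + 5) - 4 * dmod P) / (((l : ℝ) + 4) * ((l : ℝ) - 3)) * P.logDiff +
        6 * l * (((l : ℝ) + 5) - 4 * dmod P) / (((l : ℝ) + 4) * ((l : ℝ) - 3)) * (1 - 1 / (l : ℝ))
          * logCondAvoid P {2, l} := by ring
  have e2 : 0 ≤ 6 * l * (((l : ℝ) + 5) - 4 * dmod P) / (((l : ℝ) + 4) * ((l : ℝ) - 3)) * P.logDiff :=
    mul_nonneg hc₁ P.logDiff_nonneg
  have e3 : 0 < 6 * l * ((l : ℝ) + 5) / (((l : ℝ) + 4) * ((l : ℝ) - 3)) * Real.log Real.pi := mul_pos hc₂ hπ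
  linarith

/-- The per-place threshold of `exists_localHeight_gt_of_szpiroBad` is at most `8`: for `l ≥ 5` and `d ≥ 1`,
`(6l(l+5−4d)/((l+4)(l−3)))·(1 − 1/l) ≤ 8` (`= 8` at `l = 5, d = 1`; `↘ 6` as `l → ∞`; `(l+9)(l−5) ≥ 0`).  With `Cor22.dmod_pos`
(`d_mod ≥ 1`) this bounds the Szpiro side of T4 uniformly. [folklore] -/
theorem szpiroCoeff_mul_le_eight (h5 : 5 ≤ l) {d : ℝ} (hd1 : 1 ≤ d) :
    6 * l * (((l : ℝ) + 5) - 4 * d) / (((l : ℝ) + 4) * ((l : ℝ) - 3)) * (1 - 1 / (l : ℝ)) ≤ 8 := by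
  have hl5 : (5 : ℝ) ≤ l := by exact_mod_cast h5
  have hl0 : (0 : ℝ) < l := by linarith
  have hD : (0 : ℝ) < ((l : ℝ) + 4) * ((l : ℝ) - 3) := mul_pos (by linarith) (by linarith)
  have e : (1 - 1 / (l : ℝ)) = ((l : ℝ) - 1) / l := by field_simp
  rw [e, div_mul_div_comm, div_le_iff₀ (mul_pos hD hl0)]
  have h1 : 0 ≤ (l : ℝ) * ((l : ℝ) - 1) := mul_nonneg hl0.le (by linarith)
  nlinarith [mul_nonneg h1 (sub_nonneg.mpr hd1), mul_nonneg h1 (by linarith : (0 : ℝ) ≤ (l : ℝ) - 5)]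

/-- **T4, Szpiro side at the admissible `d_mod`**: the per-place lower bound of `exists_localHeight_gt_of_szpiroBad` with the threshold
replaced by the uniform constant — some bad `v ∤ 2l` has `h_v > c₁(1−1/l)`, and `c₁(1−1/l) ≤ 8` (`Cor22.dmod_pos`).  So the Szpiro-bad
disjunct never forces a local height above `8` at any single place. [claim: Mochizuki2012, status: disputed]
[cite: Mochizuki2012, IUTchIV Cor. 2.2 (ii) proof (P5) p. 46] -/
theorem exists_localHeight_gt_and_coeff_le_eight_of_szpiroBad (h5 : 5 ≤ l) (hd : (dmod P : ℝ) ≤ ((l : ℝ) + 5) / 4)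
    (hbad : 6 * l * (((l : ℝ) + 5) - 4 * dmod P) / (((l : ℝ) + 4) * ((l : ℝ) - 3))
            * (P.logDiff + (1 - 1 / (l : ℝ)) * logCondAvoid P {2, l})
          + 6 * l * ((l : ℝ) + 5) / (((l : ℝ) + 4) * ((l : ℝ) - 3)) * Real.log Real.pi < logQAvoid P {2, l}) :
    (∃ v ∈ badPlaces P, ((2 : ℕ) : 𝓞 P.F) ∉ v.asIdeal ∧ ((l : ℕ) : 𝓞 P.F) ∉ v.asIdeal ∧
      6 * l * (((l : ℝ) + 5) - 4 * dmod P) / (((l : ℝ) + 4) * ((l : ℝ) - 3)) * (1 - 1 / (l : ℝ)) < localHeight P v) ∧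
    6 * l * (((l : ℝ) + 5) - 4 * dmod P) / (((l : ℝ) + 4) * ((l : ℝ) - 3)) * (1 - 1 / (l : ℝ)) ≤ 8 :=
  ⟨exists_localHeight_gt_of_szpiroBad h5 hd hbad,
    szpiroCoeff_mul_le_eight h5 (by exact_mod_cast dmod_pos P)⟩

end Literature.IUT.LogVolume.Cor22

/-! ## §2. A uniform WINDOW-membership criterion: `−ord_{x₀}(j_E) ≤ 16·e_{x₀}` at every bad place ⇒ never deep -/

namespace Summit.ABC.IUTFork.Conditional

open Thm311 Thm311.Real Cor312 Cor312Vol Cor312Prov Literature.IUT.LogThetaLattice Literature.IUT.LogVolume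
  Literature.IUT.HodgeTheaters Literature.IUT.LogVolume.ThetaData
open Literature.NumberTheory.DiophantineGeometry.GenEll Summit.ABC.ABC.Theorems

variable {F K Fbar : Type} [Field F] [NumberField F] [Field K] [NumberField K] [Algebra F K] [Field Fbar]
  [Algebra F Fbar] [Algebra K Fbar] {E : WeierstrassCurve F} [E.IsElliptic] {l : ℕ} {Pb : BadPlacePredicates K}
  (D : InitialThetaData F K Fbar E l Pb)

/-- The arithmetic of one packet: for `p > 1`, `L ≥ 0`, `e ≥ 0`, an integer `o` with `−o ≤ 16·e`, a label index `i` with `2i + 3 ≤ l`, the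
degree-form product `p^{((i+2)(4+2L))+1} · (p^{o/(2l·e)})^{(i+1)²−1}` is `≥ 1` (exponent `≥ 4i+9 − 8((i+1)²−1)/l ≥ 0`; if `e = 0` the inner
exponent is `0` by the `x/0 = 0` convention and the product is `p^{…} ≥ 1` as well). [folklore] -/
theorem GenuineK.one_le_depthProduct_of_neg_le {p L e : ℝ} {o : ℤ} {i lN : ℕ} (hp : 1 < p) (hL : 0 ≤ L) (he : 0 ≤ e)
    (ho : (-(o : ℝ)) ≤ 16 * e) (hil : 2 * (i : ℝ) + 3 ≤ (lN : ℝ)) :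
    1 ≤ p ^ ((((i : ℕ) : ℝ) + 2) * (4 + 2 * L) + 1) * (p ^ ((o : ℝ) / (2 * (lN : ℝ) * e))) ^ (((i : ℕ) + 1) ^ 2 - 1) := by
  have hp0 : 0 < p := by linarith
  have hl0 : (0 : ℝ) < lN := by
    have : (0 : ℝ) ≤ i := Nat.cast_nonneg _
    linarith
  -- the natural-number exponent as a real number
  have hn : ((((i : ℕ) + 1) ^ 2 - 1 : ℕ) : ℝ) = ((i : ℝ) + 1) ^ 2 - 1 := by
    rw [Nat.cast_sub (Nat.one_le_pow _ _ (Nat.succ_pos _))]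
    push_cast
    ring
  -- rewrite the product as ONE real power
  rw [← Real.rpow_natCast (p ^ ((o : ℝ) / (2 * (lN : ℝ) * e))) (((i : ℕ) + 1) ^ 2 - 1),
    ← Real.rpow_mul hp0.le, ← Real.rpow_add hp0, hn]
  refine Real.one_le_rpow hp.le ?_
  -- the exponent is nonnegative
  have hcn : -(8 / (lN : ℝ)) * (((i : ℝ) + 1) ^ 2 - 1) ≤ (o : ℝ) / (2 * (lN : ℝ) * e) * (((i : ℝ) + 1) ^ 2 - 1) := by
    have hn0 : (0 : ℝ) ≤ ((i : ℝ) + 1) ^ 2 - 1 := by nlinarith [Nat.cast_nonneg (α := ℝ) i]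
    refine mul_le_mul_of_nonneg_right ?_ hn0
    rcases he.eq_or_lt with he0 | he0
    · -- `e = 0`: the inner exponent is `o / 0 = 0`
      rw [← he0, mul_zero, div_zero]
      have : (0 : ℝ) ≤ 8 / (lN : ℝ) := div_nonneg (by norm_num) hl0.le
      linarith
    · -- `e > 0`: `o/(2le) ≥ −16e/(2le) = −8/l`
      have h2le : (0 : ℝ) < 2 * (lN : ℝ) * e := by positivity
      rw [le_div_iff₀ h2le]
      have h16 : -(8 / (lN : ℝ)) * (2 * (lN : ℝ) * e) = -(16 * e) := by
        field_simp
        norm_num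
      rw [h16]
      linarith
  have hA : 4 * (i : ℝ) + 9 ≤ (((i : ℕ) : ℝ) + 2) * (4 + 2 * L) + 1 := by
    nlinarith [Nat.cast_nonneg (α := ℝ) i]
  -- `8((i+1)²−1) ≤ (4i+9)·l` since `l ≥ 2i+3`
  have hmain : (8 / (lN : ℝ)) * (((i : ℝ) + 1) ^ 2 - 1) ≤ 4 * (i : ℝ) + 9 := by
    rw [div_mul_eq_mul_div, div_le_iff₀ hl0]
    nlinarith [Nat.cast_nonneg (α := ℝ) i, mul_nonneg (Nat.cast_nonneg (α := ℝ) i) (Nat.cast_nonneg (α := ℝ) i)]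
  nlinarith

/-- **T4, depth side — a uniform WINDOW-membership criterion** (lane U): for an initial Θ-datum `D` over `K`, if EVERY bad place `x₀` of `K`
over an odd prime has `−ord_{x₀}(j_E) ≤ 16·e_{x₀}` (`e_{x₀}` the absolute ramification index), then the DATUM-ONLY depth predicate
`DeepOrd(D)` — the right-hand side of abc-iut-C-cert-2's `GenuineK.deep_iff_deepOrd` (p445646), VERBATIM — FAILS: no packet
`(p > 2, i : Fin l⋆, x₀ | p)` satisfies `p^{((i+2)(4+2·log_p[K:ℚ]))+1}·(p^{ord_{x₀}(j_E)/(2l·e_{x₀})})^{(i+1)²−1} < 1`, whatever `[K:ℚ]` is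
(`log_p[K:ℚ] ≥ 0` only raises the bar; at label `i` the exponent is `≥ 4i+9 − 8((i+1)²−1)/l ≥ 0` as `l = 2l⋆+1 ≥ 2i+3`).  So such data are
never decided by the degree form (R-deg) and sit in the WINDOW at every packet.  The depth threshold `16·e_{x₀} ≥ 16` exceeds the Szpiro-side
threshold `≤ 8` of §1: SZPIRO-BAD does not force DEEP through these numerics (T4 negative at the numeric level).
[cite: Mochizuki2012, IUTchIV Thm. 1.10 p. 22–23; IUTchIII Cor. 3.12 p. 173–174] [cite: DupuyHilado2025, §3.3, §3.4]
[claim: Mochizuki2012, status: disputed] -/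
theorem GenuineK.not_deepOrd_of_neg_ord_jE_le
    (h16 : ∀ (pp : Nat.Primes) (x₀ : (thetaIndex (pilotDataOfK D K)).Fibre (.inr pp)),
      haveI : Fact (pp : ℕ).Prime := ⟨pp.2⟩
      placeOf (pilotDataOfK D K) pp.1 x₀ ∈ (pilotDataOfK D K).S →
        (-(ord K (placeOf (pilotDataOfK D K) pp.1 x₀) (algebraMap F K E.j) : ℝ)) ≤
          16 * ramIdx K (placeOf (pilotDataOfK D K) pp.1 x₀)) :
    ¬ (∃ (pp : Nat.Primes) (_ : 2 < (pp : ℕ)) (i : Fin (thetaIndex (pilotDataOfK D K)).lstar)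
        (x₀ : (thetaIndex (pilotDataOfK D K)).Fibre (.inr pp)),
      haveI : Fact (pp : ℕ).Prime := ⟨pp.2⟩
      placeOf (pilotDataOfK D K) pp.1 x₀ ∈ (pilotDataOfK D K).S ∧
      ((pp : ℕ) : ℝ) ^ ((((i : ℕ) : ℝ) + 2) * (4 + 2 * Real.logb (pp : ℕ) (Module.finrank ℚ K)) + 1) *
        (((pp : ℕ) : ℝ) ^ ((ord K (placeOf (pilotDataOfK D K) pp.1 x₀) (algebraMap F K E.j) : ℝ) /
          (2 * l * ramIdx K (placeOf (pilotDataOfK D K) pp.1 x₀)))) ^ (((i : ℕ) + 1) ^ 2 - 1) < 1) := by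
  rintro ⟨pp, hp2, i, x₀, hS, hlt⟩
  haveI : Fact (pp : ℕ).Prime := ⟨pp.2⟩
  have hp1 : (1 : ℝ) < ((pp : ℕ) : ℝ) := by exact_mod_cast pp.2.one_lt
  have hN : (1 : ℝ) ≤ (Module.finrank ℚ K : ℝ) := by exact_mod_cast Module.finrank_pos
  have hL : 0 ≤ Real.logb (pp : ℕ) (Module.finrank ℚ K) := Real.logb_nonneg hp1 hN
  have he : (0 : ℝ) ≤ (ramIdx K (placeOf (pilotDataOfK D K) pp.1 x₀) : ℝ) := Nat.cast_nonneg _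
  -- `l = 2l⋆ + 1 ≥ 2i + 3`
  have hi : (i : ℕ) < (pilotDataOfK D K).lstar := i.2
  have hleq : (pilotDataOfK D K).l = 2 * (pilotDataOfK D K).lstar + 1 := (pilotDataOfK D K).l_eq
  have hlK : (pilotDataOfK D K).l = l := pilotDataOfK_l D K
  have hil : 2 * ((i : ℕ) : ℝ) + 3 ≤ (l : ℝ) := by
    have : 2 * (i : ℕ) + 3 ≤ l := by omega
    exact_mod_cast this
  exact absurd hlt (not_lt.mpr (GenuineK.one_le_depthProduct_of_neg_le hp1 hL he (h16 pp x₀ hS) hil))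

/-- **The same on the CHOSEN realising q-idele** (the `Deep` form of abc-iut-C-cert-1's v8K/v10K window, `‖(… qIdeles …).choose p x₀‖`):
under the per-place bound `−ord_{x₀}(j_E) ≤ 16·e_{x₀}` at the bad places, the degree-form depth inequality holds at NO packet — by
`GenuineK.deep_iff_deepOrd` (p445646). [claim: Mochizuki2012, status: disputed] [cite: DupuyHilado2025, §3.4] -/
theorem GenuineK.not_deep_of_neg_ord_jE_le
    (h16 : ∀ (pp : Nat.Primes) (x₀ : (thetaIndex (pilotDataOfK D K)).Fibre (.inr pp)),
      haveI : Fact (pp : ℕ).Prime := ⟨pp.2⟩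
      placeOf (pilotDataOfK D K) pp.1 x₀ ∈ (pilotDataOfK D K).S →
        (-(ord K (placeOf (pilotDataOfK D K) pp.1 x₀) (algebraMap F K E.j) : ℝ)) ≤
          16 * ramIdx K (placeOf (pilotDataOfK D K) pp.1 x₀)) :
    ¬ (∃ (pp : Nat.Primes) (_ : 2 < (pp : ℕ)) (i : Fin (thetaIndex (pilotDataOfK D K)).lstar)
        (x₀ : (thetaIndex (pilotDataOfK D K)).Fibre (.inr pp)),
      haveI : Fact (pp : ℕ).Prime := ⟨pp.2⟩
      ((pp : ℕ) : ℝ) ^ ((((i : ℕ) : ℝ) + 2) * (4 + 2 * Real.logb (pp : ℕ) (Module.finrank ℚ K)) + 1) *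
        ‖(exists_realising_qIdeles_pilotDataOfK D).choose pp x₀‖ ^ (((i : ℕ) + 1) ^ 2 - 1) < 1) :=
  fun h => GenuineK.not_deepOrd_of_neg_ord_jE_le D h16 ((GenuineK.deep_iff_deepOrd D).mp h)

end Summit.ABC.IUTFork.Conditional

end
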